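import Mathlib
import HarnessLib

/-!
# ζ(5) search — Families: coefficient asymptotics of powers of a positive polynomial, V — the entropy bound for
# multinomial coefficients

HONEST FRAMING: systematic search; no irrationality claim unless certified.  Cell `pub-zeta5`, certifier 2
(cert-2 g9, 2026-08-22).  Elementary real analysis (Stirling's bounds from Mathlib); no conjecture node is used;
nothing about `ζ(5)`; no number of record moves.

* `log_factorial_le` — `log m! ≤ m log m − m + (log m)/2 + 1` (from the monotonicity of the Stirling sequence),
  complementing Mathlib's lower bound `Stirling.le_log_factorial_stirling`;
* **`log_multinomial_div_ge`** — for a type `T : ι → ℕ` on a finite set `s` with `n = Σ_s T ≥ 1`: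
  `(log (n; T))/n ≥ Σ_{a ∈ s} h(T_a/n) − #s·((log n)/2 + 1)/n` with `h(x) = −x log x` (`Real.negMulLog`) — the
  multinomial coefficient of a type is `e^{n·H(type) − O(log n)}`;
* `tendsto_natDiv_div`, `tendsto_natMod_div` — `⌊n/N⌋/n → 1/N`, `(n mod N)/n → 0` (bookkeeping for types of a general
  length `n = tN + j`).
Standard axioms only.
-/

noncomputable section

open Finset Real Filter Topology

namespace Summit.KontsevichZagierPeriods.Zeta5Search.Families.Cellular

namespace CoeffAsymp

/-! ## Stirling sandwich -/

/-- **Upper Stirling bound**: `log m! ≤ m log m − m + (log m)/2 + 1` for every `m` (for `m = 0` both sides are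
harmless: `0 ≤ 1`). -/
theorem log_factorial_le (m : ℕ) : Real.log (m.factorial : ℝ) ≤ m * Real.log m - m + Real.log m / 2 + 1 := by
  rcases Nat.eq_zero_or_pos m with rfl | hm
  · simp
  · -- `stirlingSeq m ≤ stirlingSeq 1 = e/√2`, i.e. `m! ≤ (e/√2) · √(2m) · (m/e)^m = e √m (m/e)^m`
    obtain ⟨k, rfl⟩ : ∃ k, m = k + 1 := ⟨m - 1, by omega⟩
    have hanti := Stirling.stirlingSeq'_antitone (Nat.zero_le k)
    simp only [Function.comp_apply, Nat.succ_eq_add_one, zero_add, Stirling.stirlingSeq_one] at hanti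
    have hpos1 : (0 : ℝ) < ((k + 1 : ℕ) : ℝ) := by positivity
    have hden : 0 < Real.sqrt (2 * ((k + 1 : ℕ) : ℝ)) * (((k + 1 : ℕ) : ℝ) / Real.exp 1) ^ (k + 1) := by positivity
    have hseq : Stirling.stirlingSeq (k + 1) = ((k + 1).factorial : ℝ) /
        (Real.sqrt (2 * ((k + 1 : ℕ) : ℝ)) * (((k + 1 : ℕ) : ℝ) / Real.exp 1) ^ (k + 1)) := by
      rw [Stirling.stirlingSeq]
    rw [hseq, div_le_iff₀ hden] at hanti
    -- take logs
    have hfact : (0 : ℝ) < ((k + 1).factorial : ℝ) := by exact_mod_cast Nat.factorial_pos _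
    have hlog := Real.log_le_log hfact hanti
    have h2 : (0 : ℝ) < Real.sqrt 2 := Real.sqrt_pos.2 (by norm_num)
    have h2M : (0 : ℝ) < Real.sqrt (2 * ((k + 1 : ℕ) : ℝ)) := Real.sqrt_pos.2 (by positivity)
    have hrhs : Real.log (Real.exp 1 / Real.sqrt 2 *
        (Real.sqrt (2 * ((k + 1 : ℕ) : ℝ)) * (((k + 1 : ℕ) : ℝ) / Real.exp 1) ^ (k + 1))) =
        1 + Real.log ((k + 1 : ℕ) : ℝ) / 2 + (k + 1 : ℕ) * (Real.log ((k + 1 : ℕ) : ℝ) - 1) := by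
      rw [Real.log_mul (by positivity) hden.ne', Real.log_div (Real.exp_pos 1).ne' h2.ne', Real.log_exp,
        Real.log_mul h2M.ne' (by positivity), Real.log_pow, Real.log_div hpos1.ne' (Real.exp_pos 1).ne',
        Real.log_exp, Real.log_sqrt (by positivity), Real.log_sqrt (by positivity),
        Real.log_mul (by norm_num) hpos1.ne']
      ring
    rw [hrhs] at hlog
    have : (((k + 1 : ℕ) : ℝ)) * (Real.log ((k + 1 : ℕ) : ℝ) - 1) =
        ((k + 1 : ℕ) : ℝ) * Real.log ((k + 1 : ℕ) : ℝ) - ((k + 1 : ℕ) : ℝ) := by ring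
    linarith

/-- **Lower Stirling bound** (Mathlib's, with the constant dropped): `m log m − m + (log m)/2 ≤ log m!` (`m ≥ 1`). -/
theorem log_factorial_ge {m : ℕ} (hm : m ≠ 0) : m * Real.log m - m + Real.log m / 2 ≤ Real.log (m.factorial : ℝ) := by
  have h := Stirling.le_log_factorial_stirling hm
  have h1 : (1 : ℝ) ≤ 2 * Real.pi := by linarith [Real.pi_gt_three]
  have hπ : 0 ≤ Real.log (2 * Real.pi) / 2 := div_nonneg (Real.log_nonneg h1) (by norm_num)
  linarith

/-! ## The entropy bound for the multinomial coefficient of a type -/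

/-- `T_a log T_a − T_a log n = −n · h(T_a / n)` with `h = negMulLog` (also for `T_a = 0`). -/
theorem mul_log_sub_eq_negMulLog {n : ℕ} (hn : n ≠ 0) (t : ℕ) :
    (t : ℝ) * Real.log t - t * Real.log n = -(n * Real.negMulLog ((t : ℝ) / n)) := by
  have hn' : (0 : ℝ) < n := by exact_mod_cast Nat.pos_of_ne_zero hn
  rcases Nat.eq_zero_or_pos t with rfl | ht
  · simp [Real.negMulLog]
  · have ht' : (0 : ℝ) < t := by exact_mod_cast ht
    rw [Real.negMulLog, Real.log_div ht'.ne' hn'.ne']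
    field_simp

/-- **The entropy bound.**  For `T : ι → ℕ` on a finite set `s` with `n = Σ_{a ∈ s} T_a ≥ 1`:
`(log (n; T))/n ≥ Σ_{a ∈ s} h(T_a / n) − #s · ((log n)/2 + 1)/n`, `h(x) = −x log x`. -/
theorem log_multinomial_div_ge {ι : Type*} (s : Finset ι) (T : ι → ℕ) (hn : ∑ a ∈ s, T a ≠ 0) :
    ∑ a ∈ s, Real.negMulLog ((T a : ℝ) / (∑ a ∈ s, T a : ℕ)) - s.card * (Real.log (∑ a ∈ s, T a : ℕ) / 2 + 1) /
        (∑ a ∈ s, T a : ℕ) ≤ Real.log (Nat.multinomial s T : ℝ) / (∑ a ∈ s, T a : ℕ) := by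
  set n : ℕ := ∑ a ∈ s, T a with hn_def
  have hnpos : (0 : ℝ) < n := by exact_mod_cast Nat.pos_of_ne_zero hn
  have hn1 : (1 : ℝ) ≤ n := by exact_mod_cast Nat.pos_of_ne_zero hn
  -- `log (n;T) = log n! − Σ log T_a!`
  have hspec := Nat.multinomial_spec s T
  have hmult : Real.log (Nat.multinomial s T : ℝ) =
      Real.log (n.factorial : ℝ) - ∑ a ∈ s, Real.log ((T a).factorial : ℝ) := by
    have hprod_pos : (0 : ℝ) < ∏ a ∈ s, ((T a).factorial : ℝ) :=
      Finset.prod_pos fun a _ => by exact_mod_cast Nat.factorial_pos _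
    have h1 : ((∏ a ∈ s, (T a).factorial : ℕ) : ℝ) * (Nat.multinomial s T : ℝ) = (n.factorial : ℝ) := by
      rw [hn_def]; exact_mod_cast hspec
    rw [Nat.cast_prod] at h1
    have hmpos : (0 : ℝ) < (Nat.multinomial s T : ℝ) := by exact_mod_cast Nat.multinomial_pos s T
    rw [← h1, Real.log_mul hprod_pos.ne' hmpos.ne', Real.log_prod (fun a _ => ?_)]
    · ring
    · exact_mod_cast (Nat.factorial_pos _).ne'
  -- lower bound for `log n!`, upper bounds for `log T_a!`
  have hlow := log_factorial_ge hn
  have hup : ∑ a ∈ s, Real.log ((T a).factorial : ℝ) ≤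
      ∑ a ∈ s, ((T a : ℝ) * Real.log (T a) - T a + Real.log n / 2 + 1) := by
    refine Finset.sum_le_sum fun a ha => ?_
    have h1 := log_factorial_le (T a)
    have h2 : Real.log (T a : ℝ) ≤ Real.log n := by
      rcases Nat.eq_zero_or_pos (T a) with h0 | hpos
      · rw [h0, Nat.cast_zero, Real.log_zero]; exact Real.log_nonneg hn1
      · exact Real.log_le_log (by exact_mod_cast hpos)
          (by rw [hn_def]; exact_mod_cast Finset.single_le_sum (fun b _ => Nat.zero_le (T b)) ha)
    linarith
  have hsumT : ∑ a ∈ s, (T a : ℝ) = n := by rw [hn_def]; push_cast; rfl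
  -- assemble
  have hmain : (n : ℝ) * ∑ a ∈ s, Real.negMulLog ((T a : ℝ) / n) - s.card * (Real.log n / 2 + 1) ≤
      Real.log (Nat.multinomial s T : ℝ) := by
    rw [hmult]
    have hneg : ∑ a ∈ s, ((T a : ℝ) * Real.log (T a) - T a + Real.log n / 2 + 1) =
        (∑ a ∈ s, ((T a : ℝ) * Real.log (T a) - (T a : ℝ) * Real.log n)) + (n : ℝ) * Real.log n - n +
          s.card * (Real.log n / 2 + 1) := by
      rw [Finset.sum_add_distrib, Finset.sum_add_distrib, Finset.sum_sub_distrib, Finset.sum_sub_distrib,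
        Finset.sum_const, Finset.sum_const, ← Finset.sum_mul, hsumT]
      simp only [nsmul_eq_mul]
      ring
    have hent : ∑ a ∈ s, ((T a : ℝ) * Real.log (T a) - (T a : ℝ) * Real.log n) =
        -((n : ℝ) * ∑ a ∈ s, Real.negMulLog ((T a : ℝ) / n)) := by
      rw [Finset.mul_sum, ← Finset.sum_neg_distrib]
      exact Finset.sum_congr rfl fun a _ => mul_log_sub_eq_negMulLog hn (T a)
    rw [hent] at hneg
    have hlogn : 0 ≤ Real.log (n : ℝ) / 2 := div_nonneg (Real.log_nonneg hn1) (by norm_num)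
    linarith
  -- divide by `n`
  have := div_le_div_of_nonneg_right hmain hnpos.le
  rwa [sub_div, mul_div_cancel_left₀ _ hnpos.ne'] at this

/-! ## Bookkeeping limits for types of a general length -/

/-- `⌊n/N⌋ / n → 1/N`. -/
theorem tendsto_natDiv_div {N : ℕ} (hN : N ≠ 0) :
    Tendsto (fun n : ℕ => ((n / N : ℕ) : ℝ) / n) atTop (𝓝 (1 / (N : ℝ))) := by
  have hN' : (0 : ℝ) < N := by exact_mod_cast Nat.pos_of_ne_zero hN
  -- squeeze between `1/N − 1/n` and `1/N`
  have hup : ∀ n : ℕ, ((n / N : ℕ) : ℝ) / n ≤ 1 / (N : ℝ) := by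
    intro n
    rcases Nat.eq_zero_or_pos n with rfl | hn
    · simp
    · have hn' : (0 : ℝ) < n := by exact_mod_cast hn
      rw [div_le_iff₀ hn']
      calc ((n / N : ℕ) : ℝ) ≤ (n : ℝ) / N := Nat.cast_div_le
        _ = 1 / (N : ℝ) * n := by ring
  have hlow : ∀ n : ℕ, 0 < n → 1 / (N : ℝ) - 1 / n ≤ ((n / N : ℕ) : ℝ) / n := by
    intro n hn
    have hn' : (0 : ℝ) < n := by exact_mod_cast hn
    have hdm : (N : ℝ) * ((n / N : ℕ) : ℝ) + ((n % N : ℕ) : ℝ) = n := by exact_mod_cast Nat.div_add_mod n N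
    have hmod : ((n % N : ℕ) : ℝ) < N := by exact_mod_cast Nat.mod_lt n (Nat.pos_of_ne_zero hN)
    rw [le_div_iff₀ hn', sub_mul, div_mul_cancel₀ _ hn'.ne']
    have : 1 / (N : ℝ) * n = ((n / N : ℕ) : ℝ) + ((n % N : ℕ) : ℝ) / N := by
      field_simp
      linarith
    rw [this]
    have : ((n % N : ℕ) : ℝ) / N < 1 := by rw [div_lt_one hN']; exact hmod
    linarith
  have hlim : Tendsto (fun n : ℕ => 1 / (N : ℝ) - 1 / (n : ℝ)) atTop (𝓝 (1 / (N : ℝ))) := by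
    have h2 : Tendsto (fun n : ℕ => 1 / (N : ℝ) - 1 / (n : ℝ)) atTop (𝓝 (1 / (N : ℝ) - 0)) :=
      tendsto_const_nhds.sub tendsto_one_div_atTop_nhds_zero_nat
    rwa [sub_zero] at h2
  refine tendsto_of_tendsto_of_tendsto_of_le_of_le' hlim tendsto_const_nhds ?_ (Eventually.of_forall hup)
  exact (eventually_gt_atTop 0).mono fun n hn => hlow n hn

/-- `(n mod N) / n → 0` (`N ≥ 1`). -/
theorem tendsto_natMod_div {N : ℕ} (hN : N ≠ 0) :
    Tendsto (fun n : ℕ => ((n % N : ℕ) : ℝ) / n) atTop (𝓝 0) := by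
  have hup : ∀ n : ℕ, ((n % N : ℕ) : ℝ) / n ≤ (N : ℝ) * (1 / n) := by
    intro n
    rcases Nat.eq_zero_or_pos n with rfl | hn
    · simp
    · have hn' : (0 : ℝ) < n := by exact_mod_cast hn
      rw [mul_one_div]
      refine div_le_div_of_nonneg_right ?_ hn'.le
      exact_mod_cast (Nat.mod_lt n (Nat.pos_of_ne_zero hN)).le
  have hlow : ∀ n : ℕ, 0 ≤ ((n % N : ℕ) : ℝ) / n := fun n => by positivity
  have hlim : Tendsto (fun n : ℕ => (N : ℝ) * (1 / (n : ℝ))) atTop (𝓝 0) := by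
    simpa using tendsto_one_div_atTop_nhds_zero_nat.const_mul (N : ℝ)
  exact tendsto_of_tendsto_of_tendsto_of_le_of_le' tendsto_const_nhds hlim (Eventually.of_forall hlow)
    (Eventually.of_forall hup)

end CoeffAsymp

end Summit.KontsevichZagierPeriods.Zeta5Search.Families.Cellular
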